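import Summits.QuantumAdvantage.QuantumAdvantage.Theses.CubicForrelation
import Literature.Computability.QuantumComplexity.SignedCubicForrelation
import Literature.Computability.QuantumComplexity.SignedForrelationMemSpec
import Literature.Computability.QuantumComplexity.PhaseQueryUniform
import Literature.Computability.QuantumComplexity.ForrelationMemValue
import Literature.Computability.QuantumComplexity.ForrelationCircuitCode
import Literature.Computability.Cryptography.ClassBQPReductionProofs
import Literature.Computability.Complexity.CodeFPArith

/-!
# Vocabulary of line `Sketch` (idea `reduce-then-lift`) for crux `SignedExactSliceIsLift` (stmt-QuantumAdvantage-14830)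

Support file (`--supports stmt-QuantumAdvantage-14830`, route `QuantumAdvantage/CubicForrelation`, crux K2
`Summit.QuantumAdvantage.QuantumAdvantage.Theses.CubicForrelation.SignedExactSliceIsLift`
`= (NearExactIsExact → signedExactCubicForrelationProblem 2 ∈ promiseLift BQP)` by `rfl`).

THE LINE. K2 is closure of `PromiseBQP` under a TOTAL polynomial-time Karp map whose image lies inside the
promise of a θ-gapped problem: the Möbius canonicaliser `f ∈ FP` (`TotalCanonicaliser`) sends EVERY string to the
code of a WELL-FORMED cubic instance (`WF`: `B₂`-circuits, `k = 2`, `n` even, both circuits of 𝔽₂-degree `≤ 3`,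
at most one idle input wire), namely the canonical XOR-of-ANDs netlists (`anfPC`) of the degree-3 TRUNCATED MÖBIUS
INTERPOLANTS (`cubicMonomials`, `truncOf`) of the two input circuits, read as oracles on the `O(n³)` points of
weight `≤ 3`; on such codes the LANDED signed family `PhaseQuery.family SgnForrMem.paramsS` accepts with
probability exactly `1 − (1 − ((1+Φ)/2)²)³` (`LandedFamilyValueSet`), which under the crux `NearExactIsExact` is
`1` on `Φ = 1` and `≤ p₀ < 1` otherwise; exact AND-powering of a uniform family (`AndPowerAmplification`) brings
`p₀^K ≤ 1/3` while fixing `1`; the separating `BQP` language is `f⁻¹(gappedSlice.yes)`.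

This file fixes the SHARED DATA VOCABULARY of the line (no proofs, no propositions): the objects
`slice`/`WF`/`gappedSlice` and the plain list-level functions the classical stubs are ABOUT — the weight-≤3 subsets
`subsets3`, the Möbius coefficient `mcoeff` of an oracle, the monomial list `cubicMonomials`, their evaluation
`evalMonos`/`truncOf`, the mirror netlist `anfPC` (format of `ForrelationCircuitCode.lean`), the total parser `parse`
of instance codes and the canonical mirror instance `canonMirror` — so that the stub files
(`…SignedExactSliceIsLiftStub*.lean`, registered stubs of the skeleton `Cruxes/SignedExactSliceIsLift/Lines/Sketch.lean`)
and the assembly state the same terms. The stub STATEMENTS live in the skeleton (inlined over this vocabulary).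

## References

* [AaronsonAmbainis2018] S. Aaronson, A. Ambainis, *Forrelation*, SIAM J. Comput. 47 (2018), §3.2 Prop. 6, §6.
* [Carlet2020] C. Carlet, *Boolean Functions for Cryptography and Coding Theory*, CUP 2021, §2.2.1 (ANF, binary
  Möbius transform), Thm 7.
* [Watrous2009] J. Watrous, *Quantum computational complexity*, 2009, §III.2, §IV Prop. 3 (error reduction).
* [Goldreich2006] O. Goldreich, *On promise problems*, 2006, §1.2 / Def. 1.4 (Karp reductions of promise problems).
* [AroraBarak2009] S. Arora, B. Barak, *Computational Complexity*, CUP 2009, §1.3, §6.1.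
-/

set_option linter.dupNamespace false -- D-0017: single-problem summit ⇒ `QuantumAdvantage.QuantumAdvantage` by design

namespace Summit.QuantumAdvantage.QuantumAdvantage.Theorems.SignedExactSliceIsLift

open _root_.Computability Literature.Computability.Complexity Literature.Computability.Cryptography
  Literature.Computability.QuantumComplexity
open Literature.Computability.Complexity.CodeFP (strE unE natE bitE pairE rawE)
open Literature.Computability.Complexity.Brick (fstF sndF decNil)
open Summit.QuantumAdvantage.QuantumAdvantage.Theses.CubicForrelation (NearExactIsExact SignedExactSliceIsLift)

/-! ### The objects of the line -/

/-- The signed exact cubic slice (route item r3's promise problem; K2's object, `rfl` with the route's inline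
promise problem by `signedExactCubicForrelationProblem_two_eq`). [cite: AaronsonAmbainis2018, §3.2 Prop. 6] -/
def slice : PromiseProblem := signedExactCubicForrelationProblem 2

/-- WELL-FORMED CUBIC instances: `B₂`-circuits, `k = 2`, `n` even, both circuits compute functions of 𝔽₂-degree
`≤ 3`, and at most one idle input wire (`n ≤ #R + 1`, `#R = ForrMem.sR` the number of distinct input wires read
syntactically), so that the landed amplitude analysis `SgnForrMem.forrelation_cfun` applies with no idle factor.
[cite: AaronsonAmbainis2018, §6] -/
def WF : Set KForrelationInstance :=
  {I | I.IsOverB2 ∧ I.k = 2 ∧ Even I.n ∧ (∀ i, IsDegLeFun 3 (I.C i).eval) ∧ I.n ≤ ForrMem.sR I + 1}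

/-- The θ-GAPPED CANONICAL SLICE: yes = the exact yes-codes (`slice.yes` verbatim), no = codes of well-formed
cubic instances with `Φ ≠ 1` (under `NearExactIsExact`: `Φ ≤ θ`). [cite: Goldreich2006, §1.2] -/
def gappedSlice : PromiseProblem :=
  ⟨slice.yes, KForrelationInstance.encode '' {I | I ∈ WF ∧ I.value ≠ 1}⟩

/-! ### The Möbius layer (list vocabulary): weight-≤3 subsets, coefficients, monomials, evaluation -/

/-- The subsets of `{0, …, n-1}` of size `≤ 3`, as increasing index lists: `∅`, singletons, pairs, triples.
[cite: Carlet2020, §2.2.1] -/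
def subsets3 (n : ℕ) : List (List ℕ) :=
  [[]] ++ (List.range n).map (fun i => [i]) ++
    (List.range n).flatMap (fun j => (List.range j).map fun i => [i, j]) ++
    (List.range n).flatMap (fun l => (List.range l).flatMap fun j => (List.range j).map fun i => [i, j, l])

/-- The indicator bit vector of length `n` of an index list `T`. [cite: Carlet2020, §2.2.1] -/
def indic (n : ℕ) (T : List ℕ) : List Bool := (List.range n).map fun i => decide (i ∈ T)

/-- The binary MÖBIUS COEFFICIENT of an oracle `F` at the index set `S` (only its first three indices are used):
`c_S = ⊕_{T ⊆ S} F(1_T)`. [cite: Carlet2020, §2.2.1 (binary Möbius transform)] -/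
def mcoeff (n : ℕ) (F : List Bool → Bool) (S : List ℕ) : Bool :=
  (((S.take 3).sublists').map fun T => F (indic n T)).foldl (fun acc b => xor acc b) false

/-- The monomials of the degree-3 TRUNCATED MÖBIUS INTERPOLANT of an oracle: the weight-≤3 subsets with
coefficient `1`. [cite: Carlet2020, §2.2.1] -/
def cubicMonomials (n : ℕ) (F : List Bool → Bool) : List (List ℕ) := (subsets3 n).filter (mcoeff n F)

/-- The value of input index `i` (out-of-range indices read `false`). [folklore] -/
def litVal (n : ℕ) (x : Fin n → Bool) (i : ℕ) : Bool := if h : i < n then x ⟨i, h⟩ else false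

/-- The value of the monomial `∏_{i ∈ S} x_i` (only the first three indices of `S` are used). [cite: Carlet2020, §2.2.1] -/
def monoVal (n : ℕ) (S : List ℕ) (x : Fin n → Bool) : Bool := (S.take 3).all (litVal n x)

/-- The value of an XOR of monomials, accumulated left to right from `false` (the order of the netlist `anfPC`).
[cite: Carlet2020, §2.2.1] -/
def evalMonos (n : ℕ) (mons : List (List ℕ)) (x : Fin n → Bool) : Bool :=
  mons.foldl (fun acc S => xor acc (monoVal n S x)) false

/-- The degree-3 truncated Möbius interpolant of an oracle, as a Boolean function on `n` bits.
[cite: Carlet2020, §2.2.1] -/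
def truncOf (n : ℕ) (F : List Bool → Bool) : (Fin n → Bool) → Bool := evalMonos n (cubicMonomials n F)

/-! ### The canonical netlist (mirror format of `ForrelationCircuitCode.lean`) -/

/-- Truth table of the arity-0 constant-`true` gate. [cite: AroraBarak2009, §6.1] -/
def ttTrue : List Bool := [true]

/-- Truth table of the arity-0 constant-`false` gate. [cite: AroraBarak2009, §6.1] -/
def ttFalse : List Bool := [false]

/-- Truth table of the binary first projection `(v₀, v₁) ↦ v₀` (little-endian index `v₀ + 2v₁`). [cite: AroraBarak2009, §6.1] -/
def ttProj : List Bool := [false, true, false, true]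

/-- Truth table of binary AND. [cite: AroraBarak2009, §6.1] -/
def ttAnd : List Bool := [false, false, false, true]

/-- Truth table of binary XOR. [cite: AroraBarak2009, §6.1] -/
def ttXor : List Bool := [false, true, true, false]

/-- The wire of the `p`-th literal of the monomial `S` on `n` inputs: input `S[p]` if present and `< n`, the
constant-`false` gate `1` if present and out of range, the constant-`true` gate `0` if absent. [cite: AroraBarak2009, §6.1] -/
def litW (n : ℕ) (S : List ℕ) (p : ℕ) : ForrCode.Wire :=
  if p < S.length then (if S.getD p 0 < n then (false, S.getD p 0) else (true, 1)) else (true, 0)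

/-- The touch gate of input `j` (gate index `2 + j`): copies the accumulator (gate `1 + j`) and READS input `j`,
so that every input wire occurs syntactically. [cite: AroraBarak2009, §6.1] -/
def touchGate (j : ℕ) : ForrCode.PGate := (ttProj, [(true, 1 + j), (false, j)])

/-- The three gates of monomial block `m` (base index `2 + n + 3m`): `A = l₀ ∧ l₁`, `B = A ∧ l₂`,
`X = acc ⊕ B` with `acc` the previous accumulator (gate `1 + n + 3m`). [cite: AroraBarak2009, §6.1] -/
def blockGates (n m : ℕ) (S : List ℕ) : List ForrCode.PGate :=
  [(ttAnd, [litW n S 0, litW n S 1]),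
   (ttAnd, [(true, 2 + n + 3 * m), litW n S 2]),
   (ttXor, [(true, 1 + n + 3 * m), (true, 3 + n + 3 * m)])]

/-- The gate list of the canonical netlist: constants `true`, `false`; `n` touch gates; one block per monomial.
[cite: AroraBarak2009, §6.1] -/
def anfGates (n : ℕ) (mons : List (List ℕ)) : List ForrCode.PGate :=
  [(ttTrue, []), (ttFalse, [])] ++ (List.range n).map touchGate ++
    (List.range mons.length).flatMap fun m => blockGates n m (mons.getD m [])

/-- **The canonical XOR-of-ANDs netlist** of a monomial list on `n` inputs (mirror circuit; output = the last
accumulator, gate `1 + n + 3·#mons`). [cite: AroraBarak2009, §6.1] -/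
def anfPC (n : ℕ) (mons : List (List ℕ)) : ForrCode.PCirc := (anfGates n mons, (true, 1 + n + 3 * mons.length))

/-! ### The total parser and the canonical mirror instance -/

/-- Total parse of a wire code (`tag :: binary index`). [cite: AroraBarak2009, §6.1] -/
def parseWire (v : List Bool) : ForrCode.Wire := (v.headD false, bitsToNat v.tail)

/-- Total parse of a gate code `⟨truth table, [wire codes]⟩`. [cite: AroraBarak2009, §6.1] -/
def parseGate (u : List Bool) : ForrCode.PGate := (fstF u, (decNil (sndF u)).map parseWire)

/-- Total parse of a circuit code `⟨[gate codes], output wire⟩`. [cite: AroraBarak2009, §6.1] -/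
def parsePC (w : List Bool) : ForrCode.PCirc := ((decNil (fstF w)).map parseGate, parseWire (sndF w))

/-- **Total parse of an instance code** `⟨bin n, ⟨bin k, [circuit codes]⟩⟩` (every string parses; on genuine codes
it returns the mirror instance, `parse (instE t) = t`). [cite: AaronsonAmbainis2018, §6] -/
def parse (x : List Bool) : ForrCode.Inst :=
  (bitsToNat (fstF x), bitsToNat (fstF (sndF x)), (decNil (sndF (sndF x))).map parsePC)

/-- The guard: `k = 2`, `n` even, `n ≤ L + 1` (`L` the code length; on the exact slice `n ≤ #R + 1 ≤ L + 1`).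
[cite: AaronsonAmbainis2018, §6 (p. 26)] -/
def guardOK (t : ForrCode.Inst) (L : ℕ) : Bool :=
  decide (t.2.1 = 2) && (decide (Even t.1) && decide (t.1 ≤ L + 1))

/-- The canonical mirror instance of a parsed instance: under the guard, the two canonical netlists of the truncated
Möbius interpolants of the two circuit oracles on the same `n`; otherwise the fixed well-formed code `(0, 2, [0, 0])`.
[cite: Carlet2020, §2.2.1] -/
def canonOf (t : ForrCode.Inst) (L : ℕ) : ForrCode.Inst :=
  if guardOK t L then
    (t.1, 2, [anfPC t.1 (cubicMonomials t.1 (ForrCode.evalP (ForrCode.circAt t 0))),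
      anfPC t.1 (cubicMonomials t.1 (ForrCode.evalP (ForrCode.circAt t 1)))])
  else (0, 2, [anfPC 0 [], anfPC 0 []])

/-- **The canonical mirror instance of a string** (the canonicaliser before `instE`). [cite: Goldreich2006, Def. 1.4] -/
def canonMirror (x : List Bool) : ForrCode.Inst := canonOf (parse x) x.length

end Summit.QuantumAdvantage.QuantumAdvantage.Theorems.SignedExactSliceIsLift
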